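import Summits.Ventures.GridStability.Bench.KUNDUR2ACSGDeg4AOwnVDeg4Nu4ibk3m1PpRoaModel
import Summits.Ventures.GridStability.Bench.KUNDUR2ACSGDeg4AOwnVDeg4Nu4ibk3m1PpBall
import HarnessLib

/-!
# #50 «G2.a-K2A-alg-deg4» — rider «#50′ BALL» (model half): a Euclidean ball of MACHINE STATES around the synchronous
# equilibrium of the two-area model inside the degree-4 certified region, with the ∃! ROA sentence from it

Venture GRIDFUSION, cell `gridfusion`; seat gridfusion-lyap-2 (g3); rider «#50′ BALL» BOOKED LOW by lead g7 RULING 8i (2)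
2026-08-27T14:10:04Z (★★ on #50, no count; L ∧ D model-4 ∧ R1 ref-1 ∧ R2 ref-2), on top of «#50-roa» (RULING 8f (3)). Sibling of
`…Ball.lean` (recast half: weighted ball `Σ(σ² + κ²) + Σν²/4 ≤ (73/500)²` ∩ {h = 0} ⊆ {V₄ ≤ 3/28}, ONE `decide` on the coefficient
box majorant `Lyapunov/PolyRecastBox`) and of `…RoaModel.lean` (#50-roa model half: `…_model_roa_wellPosed`), which it imports;
embedding vocabulary = #22's `deg2_A_ownV_nu4ibk3m1_pp_Z` / `…_Z_eq_k` / `deg4_…_Z_mem_M` (bridge pattern). New facts: the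
elementary `sin²u + (1 − cos u)² = 2 − 2cos u ≤ u²` per relative angle (`…_ballsum_Z_le`) and the packaging.

STATEMENT (`deg4_A_ownV_deg4_nu4ibk3m1_pp_model_roa_ball`): for every common acceleration `a′` and every MACHINE STATE `x₀` of
M′ = `Kundur2A.csgPre.toModelRel (1/10) a′` with
`u₁² + u₂² + u₃² + ¼((ω₁ − ω₀)² + (ω₂ − ω₀)² + (ω₃ − ω₀)²) ≤ (73/500)²` (`u_i` = relative rotor-angle deviation of machine `i`
from the equilibrium w.r.t. the machine at bus 1, `ω_i − ω₀` = relative speed, scaled time; e.g. ONE relative angle displaced by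
≤ 0.146 rad = 8.37°, or all three by ≤ 4.83°, or one relative speed ≤ 0.292): there is EXACTLY ONE solution on `ℝ` from `x₀`, it
keeps `V₄(Z(c t)) ≤ 3/28` for all `t ≥ 0`, never pole-slips (`|u_i(t)| < π`), and `u_i(t) → 0`, `ω_i(t) − ω₀(t) → 0` (`i = 1, 2, 3`).
The window hypothesis `|u_i(0)| < π` of `…_model_roa` is discharged by the ball (`u_i² ≤ (73/500)² < π²`).

THREE COLUMNS. CERTIFIED (kernel): the inclusion of the ball in the certified piece (recast half) + this packaging. MODELLED: as
#50 / «#50-roa» (Chow–Sanchez-Gasca two-area four-machine classical model, lossy Kron reduction h12, scaled time `τ = t/√(2H/Ω)`,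
DECLARED uniform damping ratio `1/10` — census label «synthetic uniform damping on the printed two-area network»; MODEL-VALIDITY =
model-2's KUNDUR2A-CSG block + MV-λ(1/10)). VALIDATED: nothing. No sentence here says a grid is stable; the ball is a set of
initial states OF THE MODEL M′, an inner (crude, coefficient-majorant) description of the certified region.
-/

namespace Summit.Ventures.GridStability.Bench.KUNDUR2ACSG

open Set Filter Metric Topology Real
open Summit.Ventures.GridStability.Lyapunov Summit.Ventures.GridStability.Models
open Literature.Computation.Certificates Literature.Computation.Certificates.SOS

noncomputable section

/-- `sin²u + (1 − cos u)² = 2 − 2cos u ≤ u²` (from `1 − u²/2 ≤ cos u`). [folklore] -/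
private theorem sin_sq_add_one_sub_cos_sq_le (u : ℝ) : sin u ^ 2 + (1 - cos u) ^ 2 ≤ u ^ 2 := by
  nlinarith [sin_sq_add_cos_sq u, Real.one_sub_sq_div_two_le_cos (x := u)]

/-- The weighted recast ball gauge of a machine state is at most the machine-coordinate gauge:
`Σ(σᵢ² + κᵢ²) + Σνᵢ²/4 ≤ Σ uᵢ² + ¼Σ(ωᵢ − ω₀)²` (`σ = sin u`, `κ = 1 − cos u`, `ν = ω − ω₀`). [folklore] -/
theorem deg4_A_ownV_deg4_nu4ibk3m1_pp_ballsum_Z_le (x : ClassicalSwing.State 4) :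
    deg2_A_ownV_nu4ibk3m1_pp_Z x 0 ^ 2 + deg2_A_ownV_nu4ibk3m1_pp_Z x 1 ^ 2 + deg2_A_ownV_nu4ibk3m1_pp_Z x 2 ^ 2 +
      deg2_A_ownV_nu4ibk3m1_pp_Z x 3 ^ 2 + deg2_A_ownV_nu4ibk3m1_pp_Z x 4 ^ 2 + deg2_A_ownV_nu4ibk3m1_pp_Z x 5 ^ 2 +
      deg2_A_ownV_nu4ibk3m1_pp_Z x 6 ^ 2 / 4 + deg2_A_ownV_nu4ibk3m1_pp_Z x 7 ^ 2 / 4 + deg2_A_ownV_nu4ibk3m1_pp_Z x 8 ^ 2 / 4 ≤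
    RecastData.u Kundur2A.csgPre.angleOf x 1 ^ 2 + RecastData.u Kundur2A.csgPre.angleOf x 2 ^ 2 +
      RecastData.u Kundur2A.csgPre.angleOf x 3 ^ 2 +
      ((x.2 1 - x.2 0) ^ 2 + (x.2 2 - x.2 0) ^ 2 + (x.2 3 - x.2 0) ^ 2) / 4 := by
  rw [deg2_A_ownV_nu4ibk3m1_pp_Z_eq_0, deg2_A_ownV_nu4ibk3m1_pp_Z_eq_1, deg2_A_ownV_nu4ibk3m1_pp_Z_eq_2,
    deg2_A_ownV_nu4ibk3m1_pp_Z_eq_3, deg2_A_ownV_nu4ibk3m1_pp_Z_eq_4, deg2_A_ownV_nu4ibk3m1_pp_Z_eq_5,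
    deg2_A_ownV_nu4ibk3m1_pp_Z_eq_6, deg2_A_ownV_nu4ibk3m1_pp_Z_eq_7, deg2_A_ownV_nu4ibk3m1_pp_Z_eq_8]
  linarith [sin_sq_add_one_sub_cos_sq_le (RecastData.u Kundur2A.csgPre.angleOf x 1),
    sin_sq_add_one_sub_cos_sq_le (RecastData.u Kundur2A.csgPre.angleOf x 2),
    sin_sq_add_one_sub_cos_sq_le (RecastData.u Kundur2A.csgPre.angleOf x 3)]

/-- **The machine-coordinate ball lies in the certified piece**: `Σ uᵢ² + ¼Σ(ωᵢ − ω₀)² ≤ (73/500)²` ⇒ `V₄(Z x) ≤ 3/28`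
(recast half `…_V_le_level_of_ball` on `Z x ∈ M`). [folklore] -/
theorem deg4_A_ownV_deg4_nu4ibk3m1_pp_Vz_le_level_of_machine_ball (x : ClassicalSwing.State 4)
    (hball : RecastData.u Kundur2A.csgPre.angleOf x 1 ^ 2 + RecastData.u Kundur2A.csgPre.angleOf x 2 ^ 2 +
      RecastData.u Kundur2A.csgPre.angleOf x 3 ^ 2 +
      ((x.2 1 - x.2 0) ^ 2 + (x.2 2 - x.2 0) ^ 2 + (x.2 3 - x.2 0) ^ 2) / 4 ≤ (73 / 500 : ℝ) ^ 2) :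
    deg4_A_ownV_deg4_nu4ibk3m1_pp_Vz (deg2_A_ownV_nu4ibk3m1_pp_Z x) ≤ deg4_A_ownV_deg4_nu4ibk3m1_pp_level := by
  have hM := deg4_A_ownV_deg4_nu4ibk3m1_pp_Z_mem_M x
  have hZ := deg4_A_ownV_deg4_nu4ibk3m1_pp_ballsum_Z_le x
  show deg4_A_ownV_deg4_nu4ibk3m1_pp_V (deg2_A_ownV_nu4ibk3m1_pp_Z x 0) (deg2_A_ownV_nu4ibk3m1_pp_Z x 1)
      (deg2_A_ownV_nu4ibk3m1_pp_Z x 2) (deg2_A_ownV_nu4ibk3m1_pp_Z x 3) (deg2_A_ownV_nu4ibk3m1_pp_Z x 4)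
      (deg2_A_ownV_nu4ibk3m1_pp_Z x 5) (deg2_A_ownV_nu4ibk3m1_pp_Z x 6) (deg2_A_ownV_nu4ibk3m1_pp_Z x 7)
      (deg2_A_ownV_nu4ibk3m1_pp_Z x 8) ≤ 3 / 28
  exact deg4_A_ownV_deg4_nu4ibk3m1_pp_V_le_level_of_ball _ _ _ _ _ _ _ _ _ hM.1 hM.2.1 hM.2.2 (by linarith)

/-- **«#50′ BALL» — the ROA sentence from a Euclidean ball of machine states (two-area four-machine model, uniform damping ratio
`1/10`, any common acceleration `a′`).** For every machine state `x₀` with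
`u₁² + u₂² + u₃² + ¼((ω₁ − ω₀)² + (ω₂ − ω₀)² + (ω₃ − ω₀)²) ≤ (73/500)²`: (i) there is EXACTLY ONE solution of
`Kundur2A.csgPre.toModelRel (1/10) a′` on `ℝ` with `c 0 = x₀`; (ii) every such solution keeps `V₄(Z(c t)) ≤ 3/28` for all
`t ≥ 0`, never pole-slips, and has `u_i(t) → 0`, `ω_i(t) − ω₀(t) → 0` (`i = 1, 2, 3`). The only hypothesis is the initial machine
state. MODELLED/CERTIFIED columns as in the module docstring. [folklore] -/
theorem deg4_A_ownV_deg4_nu4ibk3m1_pp_model_roa_ball (a : ℝ) {x₀ : ClassicalSwing.State 4}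
    (hball : RecastData.u Kundur2A.csgPre.angleOf x₀ 1 ^ 2 + RecastData.u Kundur2A.csgPre.angleOf x₀ 2 ^ 2 +
      RecastData.u Kundur2A.csgPre.angleOf x₀ 3 ^ 2 +
      ((x₀.2 1 - x₀.2 0) ^ 2 + (x₀.2 2 - x₀.2 0) ^ 2 + (x₀.2 3 - x₀.2 0) ^ 2) / 4 ≤ (73 / 500 : ℝ) ^ 2) :
    (∃! c : ℝ → ClassicalSwing.State 4, c 0 = x₀ ∧ (Kundur2A.csgPre.toModelRel (1 / 10) a).IsSolutionOn c univ) ∧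
    ∀ c : ℝ → ClassicalSwing.State 4, c 0 = x₀ → (Kundur2A.csgPre.toModelRel (1 / 10) a).IsSolutionOn c univ →
      (∀ t, 0 ≤ t → deg4_A_ownV_deg4_nu4ibk3m1_pp_Vz (deg2_A_ownV_nu4ibk3m1_pp_Z (c t)) ≤ deg4_A_ownV_deg4_nu4ibk3m1_pp_level) ∧
      (∀ i : Fin 3, ∀ t, 0 ≤ t → |RecastData.u Kundur2A.csgPre.angleOf (c t) i.succ| < π) ∧
      (∀ i : Fin 3, Tendsto (fun t ↦ RecastData.u Kundur2A.csgPre.angleOf (c t) i.succ) atTop (𝓝 0)) ∧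
      (∀ i : Fin 3, Tendsto (fun t ↦ (c t).2 i.succ - (c t).2 0) atTop (𝓝 0)) := by
  have hV := deg4_A_ownV_deg4_nu4ibk3m1_pp_Vz_le_level_of_machine_ball x₀ hball
  have hsq : ∀ x : ClassicalSwing.State 4, 0 ≤ (x.2 1 - x.2 0) ^ 2 + (x.2 2 - x.2 0) ^ 2 + (x.2 3 - x.2 0) ^ 2 :=
    fun x ↦ by positivity
  have hwin : ∀ i : Fin 3, |RecastData.u Kundur2A.csgPre.angleOf x₀ i.succ| < π := by
    intro i
    have hpi := Real.pi_gt_three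
    have h73 : (73 / 500 : ℝ) ^ 2 ≤ 1 := by norm_num
    have hsq1 : RecastData.u Kundur2A.csgPre.angleOf x₀ i.succ ^ 2 ≤ 1 := by
      fin_cases i
      · show RecastData.u Kundur2A.csgPre.angleOf x₀ 1 ^ 2 ≤ 1
        nlinarith [sq_nonneg (RecastData.u Kundur2A.csgPre.angleOf x₀ 2), sq_nonneg (RecastData.u Kundur2A.csgPre.angleOf x₀ 3), hsq x₀]
      · show RecastData.u Kundur2A.csgPre.angleOf x₀ 2 ^ 2 ≤ 1
        nlinarith [sq_nonneg (RecastData.u Kundur2A.csgPre.angleOf x₀ 1), sq_nonneg (RecastData.u Kundur2A.csgPre.angleOf x₀ 3), hsq x₀]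
      · show RecastData.u Kundur2A.csgPre.angleOf x₀ 3 ^ 2 ≤ 1
        nlinarith [sq_nonneg (RecastData.u Kundur2A.csgPre.angleOf x₀ 1), sq_nonneg (RecastData.u Kundur2A.csgPre.angleOf x₀ 2), hsq x₀]
    have h1 := (sq_le_one_iff_abs_le_one _).1 hsq1
    linarith
  have hγ0 : (0 : ℝ) < deg4_A_ownV_deg4_nu4ibk3m1_pp_level := by
    unfold deg4_A_ownV_deg4_nu4ibk3m1_pp_level; norm_num
  exact deg4_A_ownV_deg4_nu4ibk3m1_pp_model_roa_wellPosed a hγ0 le_rfl hV hwin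

end

end Summit.Ventures.GridStability.Bench.KUNDUR2ACSG
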